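import Summits.NavierStokesRegularity.NavierStokesRegularity.Theorems.QuietScarPocketDoorZoomTopBounds
import Summits.NavierStokesRegularity.NavierStokesRegularity.Theorems.ScalingDefectPeepholeDoorAnnularPressure
import Literature.Analysis.FluidPDE.SereginSverakPressureProofs

/-!
# QuietScarPocketDoorAnyWindowLocal — plate PX of ROUND-29 §8 (nsreg-p1 g25 `r29/Sketch31C.lean` ec23287f089fe884),
# part 1: OFF-APEX LOCAL DATA of a one-point Type-I solution (velocity, gradient and pressure bounds up to the top)

Seat nsreg-C26-p1 g4 (DIRECTOR-NS #206 (2) / #208 (1)); `--supports stmt-NavierStokesRegularity-0056 --as helper`.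

For the class of the S15/S31 doors — `(u,p)` classical on `[0,T)`, Leray–Hopf, with the LOCAL ONE-POINT Type-I bound
`‖u(t,x)‖ (‖x − x₀‖ + √(ν(T−t))) ≤ M` on `Q_ρ(x₀,T)` — and a point `y ≠ x₀` of the Type-I ball, this file builds the
Pineau–Vicol frame CENTRED AT `y` (NOT at the apex): `v = (λ/ν) u(T + β·, y + λ·)`, `q = (λ/ν)²(p − p(·,y))(T + β·, y + λ·)`,
`λ² = νβ`, at a scale `λ ≤ dist(y,x₀)/8` below which

* `v` is BOUNDED on `[−1,0) × B₁` (the one-point bound off the apex: `‖u‖ ≤ 2|M|/‖y − x₀‖`);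
* `∇u` is bounded up to the top on `(T − β₂/4, T) × B(y, Λ/2)`, `Λ = 4λ`, `β₂ = Λ²/ν` (`exists_offApex_fderiv_bound`): the frame at
  scale `Λ` is a bounded classical pair on the unit cylinder whose pressure, re-gauged by Tao's TIME gauge
  `c(t) = p(t,0) − p̃[u(t)](0)`, has finite `L^{3/2}` mass (C26-g3's `SereginSverak2002.lintegral_slab_gauged_pressure_lt_top`
  transported by `setLIntegral_preimage_comp_stAffine`; the gauge is locally integrable by
  `SereginSverak2002.exists_pressure_gauge_of_classical` (2)), so imp-p1's `exists_cylinder_regularity`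
  (`NSBoundedHigherRegularityBounds_holds`) applies;
* the PRESSURE is bounded up to the top after the point gauge at `y`: `|p(t,x) − p(t,y)| ≤ 2B` on `(T−β, T) × B(y,λ)`
  (`exists_offApex_pressure_bound`: Tao's normalised pressure `p̃[u(t)]` is bounded there by
  `abs_normalisedPressure_le_weighted_scale` + `weightedFar_le_of_energy` — the S30 `AnnularPressure` pattern, off the apex
  instead of on the window annulus — and `abs_pressure_sub_le_of_normalisedPressure_le`).

`exists_offApex_pvFrame` packages the frame: classical on `[−1,0) × B₁` (`pvFrame_isClassical`), `‖v‖ ≤ A`, `|q| ≤ P`.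
Part 2 (`QuietScarPocketDoorAnyWindowTrace`) feeds it to LEG F (`terminalSliceVelocityAnalyticity_holds`).

WHAT THIS IS NOT: local bookkeeping for a corollary door about HYPOTHETICAL Type-I profiles; item 0056 `NoTypeII` and
Navier–Stokes regularity are NOT proved.  [Tao2011 Lemma 4.1 (i); SereginSverak2009 §2 p. 8; PineauVicol2026 §9]
-/

noncomputable section

set_option linter.dupNamespace false

namespace Summit.NavierStokesRegularity.NavierStokesRegularity.Theorems.QuietScarPocketDoor

open MeasureTheory Set Function Filter Topology TopologicalSpace Metric
open scoped NNReal ENNReal Topology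
open Literature.Analysis Literature.Analysis.FluidPDE
open Summit.NavierStokesRegularity.NavierStokesRegularity.Theorems.PeepholeVorticityDoor
  (pvFrame_isClassical pv_region_eq_preimage)
open Summit.NavierStokesRegularity.NavierStokesRegularity.Theorems.ScalingDefectPeepholeDoor
  (abs_normalisedPressure_le_weighted_scale weightedFar_le_of_energy abs_pressure_sub_le_of_normalisedPressure_le
    continuousOn_pressure_time)

variable {ν T : ℝ} {u : ℝ → EuclideanSpace ℝ (Fin 3) → EuclideanSpace ℝ (Fin 3)}
  {p : ℝ → EuclideanSpace ℝ (Fin 3) → ℝ}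

/-- **Tao's time gauge is locally integrable on the Pineau–Vicol cylinder.**  For the item's classical Leray–Hopf pair,
`0 < β < T`, any `κ` and any point `y`, the function `s ↦ κ (c(T + βs) − p(T + βs, y))`, `c(t) = p(t,0) − p̃[u(t)](0)`, is
locally integrable on the open unit cylinder `Q((0,0),1) = (−1,0) × B₁` (read as a function of space–time): on every
sub-slab `(−1, s₂) × B₁`, `s₂ < 0`, the gauge agrees a.e. with a bounded measurable function
(`SereginSverak2002.exists_pressure_gauge_of_classical` (2)) and `s ↦ p(T + βs, y)` is continuous.
[cite: Tao2011, Lemma 4.1 (i)] -/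
theorem locallyIntegrableOn_pv_timeGauge (hν : 0 < ν) (hT : 0 < T)
    (hcl : IsClassicalNSSolutionOn (Ico 0 T) ν 0 u p) (hLH : IsLerayHopfOn T ν 0 (u 0) u)
    {β : ℝ} (hβ : 0 < β) (hβT : β < T) (κ : ℝ) (y : EuclideanSpace ℝ (Fin 3)) :
    LocallyIntegrableOn
      (fun w : ℝ × EuclideanSpace ℝ (Fin 3) =>
        κ * ((p (T + β * w.1) 0 - normalisedPressure (u (T + β * w.1)) 0) - p (T + β * w.1) y))
      (parabolicCylinder 1 (0 : ℝ × EuclideanSpace ℝ (Fin 3))) volume := by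
  intro w hw
  rw [mem_parabolicCylinder] at hw
  obtain ⟨⟨hw1, hw2⟩, hw3⟩ := hw
  simp only [Prod.fst_zero, Prod.snd_zero] at hw1 hw2 hw3
  -- the sub-slab `U = (−1, s₂) × B₁`, `s₂ = w.1/2 < 0`
  set s₂ : ℝ := w.1 / 2 with hs₂
  have hs₂0 : s₂ < 0 := by rw [hs₂]; linarith
  have hws₂ : w.1 < s₂ := by rw [hs₂]; linarith
  set U : Set (ℝ × EuclideanSpace ℝ (Fin 3)) := Ioo (-1 : ℝ) s₂ ×ˢ ball (0 : EuclideanSpace ℝ (Fin 3)) 1 with hU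
  have hUo : IsOpen U := isOpen_Ioo.prod isOpen_ball
  have hwU : w ∈ U := mk_mem_prod ⟨by linarith, hws₂⟩ (mem_ball.2 hw3)
  refine ⟨U, mem_nhdsWithin_of_mem_nhds (hUo.mem_nhds hwU), ?_⟩
  have hUfin : volume U ≠ ⊤ := by
    rw [hU, Measure.volume_eq_prod, Measure.prod_prod, Real.volume_Ioo]
    exact ENNReal.mul_ne_top ENNReal.ofReal_ne_top measure_ball_lt_top.ne
  -- physical times of `U` lie in `[T − β, T')`, `T' = T + β s₂ < T`
  set T' : ℝ := T + β * s₂ with hT'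
  have hT'T : T' < T := by rw [hT']; nlinarith
  have htime : ∀ s ∈ Ioo (-1 : ℝ) s₂, T + β * s ∈ Ico 0 T ∧ T + β * s ∈ Icc 0 T' := by
    intro s hs
    have h1 : 0 ≤ T + β * s := by nlinarith [hs.1]
    have h2 : T + β * s ≤ T' := by rw [hT']; nlinarith [hs.2]
    exact ⟨⟨h1, by linarith⟩, ⟨h1, h2⟩⟩
  -- (a) the bounded measurable representative of the gauge on `[0, T']`
  obtain ⟨C, Mb, hCm, hCb, hae⟩ := (SereginSverak2002.exists_pressure_gauge_of_classical hν hT hcl hLH).2 T' hT'T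
  have hF : IntegrableOn (fun w : ℝ × EuclideanSpace ℝ (Fin 3) => κ * (C (T + β * w.1) - p (T + β * w.1) y)) U volume := by
    -- `C ∘ τ` bounded measurable, `p(τ ·, y)` continuous on the closure
    have hτ : Continuous fun w : ℝ × EuclideanSpace ℝ (Fin 3) => T + β * w.1 :=
      continuous_const.add (continuous_const.mul continuous_fst)
    have hC' : AEStronglyMeasurable (fun w : ℝ × EuclideanSpace ℝ (Fin 3) => C (T + β * w.1)) volume :=
      (hCm.comp hτ.measurable).aestronglyMeasurable
    have hCint : IntegrableOn (fun w : ℝ × EuclideanSpace ℝ (Fin 3) => C (T + β * w.1)) U volume :=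
      Measure.integrableOn_of_bounded hUfin hC' (Eventually.of_forall fun w => by
        rw [Real.norm_eq_abs]; exact hCb _)
    have hpcont : ContinuousOn (fun w : ℝ × EuclideanSpace ℝ (Fin 3) => p (T + β * w.1) y)
        (Icc (-1 : ℝ) s₂ ×ˢ closedBall (0 : EuclideanSpace ℝ (Fin 3)) 1) := by
      have h1 : ContinuousOn (fun s : ℝ => p (T + β * s) y) (Icc (-1 : ℝ) s₂) := by
        refine (continuousOn_pressure_time hcl y).comp (continuous_const.add (continuous_const.mul continuous_id)).continuousOn
          fun s hs => ?_
        exact ⟨by nlinarith [hs.1], by nlinarith [hs.2]⟩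
      exact h1.comp continuous_fst.continuousOn fun w hw => (mem_prod.1 hw).1
    have hpint : IntegrableOn (fun w : ℝ × EuclideanSpace ℝ (Fin 3) => p (T + β * w.1) y) U volume :=
      (hpcont.integrableOn_compact ((isCompact_Icc.prod (isCompact_closedBall _ _)))).mono_set
        (prod_mono Ioo_subset_Icc_self ball_subset_closedBall)
    exact (hCint.sub hpint).const_mul κ
  -- (b) the true gauge agrees with `C ∘ τ` a.e. on `U`
  refine hF.congr_fun_ae ?_
  -- the bad time set is null, and so is its affine preimage times the ball
  have hN : volume {t : ℝ | t ∈ Icc 0 T' ∧ ¬ (p t 0 - normalisedPressure (u t) 0 = C t)} = 0 := by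
    have := (ae_restrict_iff' measurableSet_Icc).1 hae
    rw [ae_iff] at this
    convert this using 2
    ext t
    simp only [mem_setOf_eq, Classical.not_imp]
  set N : Set ℝ := {t : ℝ | t ∈ Icc 0 T' ∧ ¬ (p t 0 - normalisedPressure (u t) 0 = C t)} with hNdef
  have hNτ : volume ((fun s : ℝ => T + β * s) ⁻¹' N) = 0 := by
    have e : (fun s : ℝ => T + β * s) ⁻¹' N = (fun s : ℝ => β * s) ⁻¹' ((fun r : ℝ => T + r) ⁻¹' N) := by
      ext s; simp
    rw [e, Real.volume_preimage_mul_left hβ.ne', measure_preimage_add, hN, mul_zero]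
  rw [Filter.EventuallyEq, ae_restrict_iff' hUo.measurableSet, ae_iff]
  refine measure_mono_null (t := ((fun s : ℝ => T + β * s) ⁻¹' N) ×ˢ (univ : Set (EuclideanSpace ℝ (Fin 3)))) ?_ ?_
  · intro w' hw'
    obtain ⟨hwU', hne⟩ := Classical.not_imp.1 hw'
    refine mk_mem_prod ?_ (mem_univ _)
    rw [mem_preimage, hNdef, mem_setOf_eq]
    refine ⟨(htime w'.1 (mem_prod.1 hwU').1).2, fun h => hne ?_⟩
    rw [h]
  · rw [Measure.volume_eq_prod, Measure.prod_prod, hNτ, zero_mul]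

/-- **Gradient bound up to the top, off the apex.**  For the item's classical Leray–Hopf pair and a point `y`, a scale
`Λ > 0` with `β₂ = Λ²/ν < T`, and a velocity bound `‖u‖ ≤ A₀` on the cylinder `[T − β₂, T) × B(y,Λ)`: there is `M₁` with
`‖∇u(t,x)‖ ≤ M₁` for `t ∈ (T − β₂/4, T)`, `x ∈ B(y, Λ/2)` — the Pineau–Vicol frame at scale `Λ` centred at `y` is a bounded
classical pair on the unit cylinder whose time-gauged pressure has finite `L^{3/2}` mass, so `exists_cylinder_regularity`
bounds its gradient on the half cylinder; pull back by `fderiv_smul_stPull_slice`.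
[cite: SereginSverak2009, §2 p. 8; Tao2011, Lemma 4.1 (i)] -/
theorem exists_offApex_fderiv_bound (hν : 0 < ν) (hT : 0 < T)
    (hcl : IsClassicalNSSolutionOn (Ico 0 T) ν 0 u p) (hLH : IsLerayHopfOn T ν 0 (u 0) u)
    (y : EuclideanSpace ℝ (Fin 3)) {Λ A₀ : ℝ} (hΛ : 0 < Λ) (hβ₂T : Λ ^ 2 / ν < T)
    (hA₀ : ∀ t ∈ Ico (T - Λ ^ 2 / ν) T, ∀ x ∈ ball y Λ, ‖u t x‖ ≤ A₀) :
    ∃ M₁ : ℝ, ∀ t ∈ Ioo (T - Λ ^ 2 / ν / 4) T, ∀ x ∈ ball y (Λ / 2), ‖fderiv ℝ (u t) x‖ ≤ M₁ := by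
  set β₂ : ℝ := Λ ^ 2 / ν with hβ₂
  have hβ₂0 : 0 < β₂ := by positivity
  have hΛeq : Real.sqrt (ν * β₂) = Λ := by
    rw [hβ₂, show ν * (Λ ^ 2 / ν) = Λ ^ 2 by field_simp, Real.sqrt_sq hΛ.le]
  -- the frame at scale `Λ`, gauge point `y`
  set v : ℝ → EuclideanSpace ℝ (Fin 3) → EuclideanSpace ℝ (Fin 3) := (Λ / ν) • stPull β₂ Λ T y u with hv
  set q : ℝ → EuclideanSpace ℝ (Fin 3) → ℝ := (Λ / ν) ^ 2 • stPull β₂ Λ T y (fun t x => p t x - p t y) with hq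
  have hreg : IsClassicalNSSolutionOnRegion (Ico (-1 : ℝ) 0 ×ˢ ball (0 : EuclideanSpace ℝ (Fin 3)) 1) 1 0 v q := by
    have := pvFrame_isClassical hν hcl hβ₂0 hβ₂T y y
    rwa [hΛeq] at this
  have hcyl : parabolicCylinder 1 (0 : ℝ × EuclideanSpace ℝ (Fin 3)) =
      Ioo (-1 : ℝ) 0 ×ˢ ball (0 : EuclideanSpace ℝ (Fin 3)) 1 := by
    rw [parabolicCylinder]; simp
  have hreg' : IsClassicalNSSolutionOnRegion (parabolicCylinder 1 (0 : ℝ × EuclideanSpace ℝ (Fin 3))) 1 0 v q := by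
    rw [hcyl]
    exact hreg.mono_of_isOpen (prod_mono Ioo_subset_Ico_self Subset.rfl) (isOpen_Ioo.prod isOpen_ball)
  -- velocity bound in the frame
  have hA : ∀ w ∈ parabolicCylinder 1 (0 : ℝ × EuclideanSpace ℝ (Fin 3)), ‖v w.1 w.2‖ ≤ Λ / ν * |A₀| := by
    intro w hw
    rw [hcyl] at hw
    obtain ⟨hs, hz⟩ := mem_prod.1 hw
    have ht : T + β₂ * w.1 ∈ Ico (T - Λ ^ 2 / ν) T := ⟨by nlinarith [hs.1], by nlinarith [hs.2]⟩
    have hx : y + Λ • w.2 ∈ ball y Λ := by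
      rw [mem_ball, dist_eq_norm, add_sub_cancel_left, norm_smul, Real.norm_of_nonneg hΛ.le]
      rw [mem_ball, dist_zero_right] at hz
      nlinarith
    rw [hv, smul_stPull_apply, norm_smul, Real.norm_of_nonneg (by positivity : (0 : ℝ) ≤ Λ / ν)]
    exact mul_le_mul_of_nonneg_left ((hA₀ _ ht _ hx).trans (le_abs_self _)) (by positivity)
  -- the time gauge and the `L^{3/2}` mass of `q − h`
  set h : ℝ → ℝ := fun s =>
    (Λ / ν) ^ 2 * ((p (T + β₂ * s) 0 - normalisedPressure (u (T + β₂ * s)) 0) - p (T + β₂ * s) y) with hh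
  have hhli : LocallyIntegrableOn (fun w : ℝ × EuclideanSpace ℝ (Fin 3) => h w.1)
      (parabolicCylinder 1 (0 : ℝ × EuclideanSpace ℝ (Fin 3))) volume :=
    locallyIntegrableOn_pv_timeGauge hν hT hcl hLH hβ₂0 hβ₂T ((Λ / ν) ^ 2) y
  -- `q − h = (Λ/ν)² g ∘ Φ` with `g` the time-gauged pressure
  set g : ℝ → EuclideanSpace ℝ (Fin 3) → ℝ := fun t x => p t x - (p t 0 - normalisedPressure (u t) 0) with hg
  have hqh : ∀ w : ℝ × EuclideanSpace ℝ (Fin 3),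
      q w.1 w.2 - h w.1 = (Λ / ν) ^ 2 * g (T + β₂ * w.1) (y + Λ • w.2) := by
    intro w
    simp only [hq, hh, hg, smul_stPull_apply, smul_eq_mul]
    ring
  have hslab := SereginSverak2002.lintegral_slab_gauged_pressure_lt_top hν hT hcl hLH
  set Pm : ℝ≥0∞ := ENNReal.ofReal (β₂ * Λ ^ 3)⁻¹ * (‖(Λ / ν) ^ 2‖ₑ ^ (3 / 2 : ℝ) *
    ∫⁻ z in Ioo 0 T ×ˢ (univ : Set (EuclideanSpace ℝ (Fin 3))), ‖g z.1 z.2‖ₑ ^ (3 / 2 : ℝ)) with hPm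
  have hPm_top : Pm ≠ ⊤ := by
    refine ENNReal.mul_ne_top ENNReal.ofReal_ne_top (ENNReal.mul_ne_top ?_ hslab.ne)
    exact ENNReal.rpow_ne_top_of_nonneg (by norm_num) enorm_ne_top
  have hP : ∫⁻ w in parabolicCylinder 1 (0 : ℝ × EuclideanSpace ℝ (Fin 3)),
      ‖q w.1 w.2 - h w.1‖ₑ ^ (3 / 2 : ℝ) ≤ (Pm.toNNReal : ℝ≥0∞) := by
    rw [ENNReal.coe_toNNReal hPm_top, hPm, hcyl, pv_region_eq_preimage hβ₂0 hΛ T y]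
    have hF := setLIntegral_preimage_comp_stAffine hβ₂0 hΛ T y
      (fun z : ℝ × EuclideanSpace ℝ (Fin 3) => ‖(Λ / ν) ^ 2 * g z.1 z.2‖ₑ ^ (3 / 2 : ℝ))
      (Ioo (T - β₂) T ×ˢ ball y Λ)
    simp only [stAffine_fst, stAffine_snd, finrank_euclideanSpace_fin] at hF
    have e1 : (fun w : ℝ × EuclideanSpace ℝ (Fin 3) => ‖q w.1 w.2 - h w.1‖ₑ ^ (3 / 2 : ℝ)) =
        fun w => ‖(Λ / ν) ^ 2 * g (T + β₂ * w.1) (y + Λ • w.2)‖ₑ ^ (3 / 2 : ℝ) := by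
      funext w; rw [hqh]
    rw [e1, hF]
    refine mul_le_mul_right ?_ _
    have e2 : ∀ z : ℝ × EuclideanSpace ℝ (Fin 3), ‖(Λ / ν) ^ 2 * g z.1 z.2‖ₑ ^ (3 / 2 : ℝ) =
        ‖(Λ / ν) ^ 2‖ₑ ^ (3 / 2 : ℝ) * ‖g z.1 z.2‖ₑ ^ (3 / 2 : ℝ) := by
      intro z
      rw [enorm_mul, ENNReal.mul_rpow_of_nonneg _ _ (by norm_num)]
    simp_rw [e2]
    rw [lintegral_const_mul' _ _ (ENNReal.rpow_ne_top_of_nonneg (by norm_num) enorm_ne_top)]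
    refine mul_le_mul_right (lintegral_mono_set (prod_mono ?_ (subset_univ _))) _
    exact Ioo_subset_Ioo_left (by linarith)
  -- interior regularity on the half cylinder
  obtain ⟨K, C, α₀, α₁, -, -, -, hreg3⟩ := exists_cylinder_regularity 1 (Λ / ν * |A₀|) Pm.toNNReal one_pos
  obtain ⟨hK, -, -⟩ := hreg3 v q h (0 : ℝ × EuclideanSpace ℝ (Fin 3)) hreg' hA hhli hP
  -- pull back to physical variables
  refine ⟨(Λ / ν * Λ)⁻¹ * K, fun t ht x hx => ?_⟩
  set s : ℝ := (t - T) / β₂ with hs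
  set z : EuclideanSpace ℝ (Fin 3) := Λ⁻¹ • (x - y) with hz
  have hts : T + β₂ * s = t := by rw [hs]; field_simp; ring
  have hxz : y + Λ • z = x := by rw [hz, smul_smul, mul_inv_cancel₀ hΛ.ne', one_smul, add_sub_cancel]
  have hsI : s ∈ Ioo (-(1 / 2) ^ 2 : ℝ) 0 := by
    obtain ⟨ht1, ht2⟩ := ht
    refine ⟨?_, ?_⟩
    · rw [hs, lt_div_iff₀ hβ₂0]; rw [hβ₂] at ht1 ⊢; nlinarith
    · rw [hs]; exact div_neg_of_neg_of_pos (by linarith) hβ₂0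
  have hzI : z ∈ ball (0 : EuclideanSpace ℝ (Fin 3)) (1 / 2) := by
    rw [mem_ball, dist_zero_right, hz, norm_smul, norm_inv, Real.norm_of_nonneg hΛ.le]
    rw [mem_ball, dist_eq_norm] at hx
    rw [inv_mul_lt_iff₀ hΛ]
    linarith
  have hw : ((s, z) : ℝ × EuclideanSpace ℝ (Fin 3)) ∈ parabolicCylinder (1 / 2) (0 : ℝ × EuclideanSpace ℝ (Fin 3)) := by
    rw [mem_parabolicCylinder]
    simp only [Prod.fst_zero, Prod.snd_zero, zero_sub, dist_zero_right]
    rw [mem_ball, dist_zero_right] at hzI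
    exact ⟨hsI, hzI⟩
  have hK1 := hK (s, z) hw 1 (by norm_num)
  rw [norm_iteratedFDeriv_one] at hK1
  -- `D(v s)(z) = (Λ/ν·Λ) D(u t)(x)`
  have htI : t ∈ Ico 0 T := ⟨by obtain ⟨ht1, _⟩ := ht; nlinarith [hβ₂0, hβ₂T], ht.2⟩
  have hd : Differentiable ℝ (u (T + β₂ * s)) := by
    rw [hts]; exact (hcl.contDiff_velocity htI).differentiable (by simp)
  have hfd := fderiv_smul_stPull_slice (α := Λ / ν) (β := β₂) (γ := Λ) (t₀ := T) (x₀ := y) (u := u) (s := s) hd z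
  rw [hts, hxz] at hfd
  have hvs : fderiv ℝ (v s) z = (Λ / ν * Λ) • fderiv ℝ (u t) x := by rw [hv]; exact hfd
  have hpos : 0 < Λ / ν * Λ := by positivity
  have hnorm : ‖fderiv ℝ (u t) x‖ = (Λ / ν * Λ)⁻¹ * ‖fderiv ℝ (v s) z‖ := by
    rw [hvs, norm_smul, Real.norm_of_nonneg hpos.le, ← mul_assoc, inv_mul_cancel₀ hpos.ne', one_mul]
  rw [hnorm]
  exact mul_le_mul_of_nonneg_left hK1 (by positivity)

/-- **Pressure bound up to the top, off the apex (point gauge).**  For the item's classical Leray–Hopf pair with the local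
one-point Type-I bound on `Q_ρ(x₀,T)` and `y ≠ x₀` in `B(x₀,ρ)`: there are a scale `λ > 0` with `λ² = νβ`, `β < T`,
`B(y,λ) ⊆ B(x₀,ρ) ∖ {x₀}`, a velocity bound `A₀` on `[T−β, T) × B(y,λ)` and a pressure level `P₀` with
`|p(t,x) − p(t,y)| ≤ P₀` for `t ∈ (T−β,T)`, `x ∈ B(y,λ)`.  (Normalised pressure bounded by the local `C¹` data of
`exists_offApex_fderiv_bound` and the energy; Tao's gauge turns it into a bound for the point-gauged pressure.)
[cite: Tao2011, Lemma 4.1 (i); PineauVicol2026, Prop. 9.5 proof] -/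
theorem exists_offApex_pressure_bound (hν : 0 < ν) (hT : 0 < T)
    (hcl : IsClassicalNSSolutionOn (Ico 0 T) ν 0 u p) (hLH : IsLerayHopfOn T ν 0 (u 0) u)
    {x₀ : EuclideanSpace ℝ (Fin 3)} {ρ M : ℝ} (hρ : 0 < ρ)
    (hM : ∀ t ∈ Ico 0 T, T - ρ ^ 2 < t → ∀ x ∈ ball x₀ ρ, ‖u t x‖ * (‖x - x₀‖ + Real.sqrt (ν * (T - t))) ≤ M)
    {y : EuclideanSpace ℝ (Fin 3)} (hy : y ∈ ball x₀ ρ) (hy0 : y ≠ x₀) :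
    ∃ lam A₀ P₀ : ℝ, 0 < lam ∧ lam ^ 2 / ν < T ∧ 0 ≤ A₀ ∧ 0 ≤ P₀ ∧
      (∀ x ∈ ball y lam, x ∈ ball x₀ ρ ∧ x ≠ x₀) ∧
      (∀ t ∈ Ico (T - lam ^ 2 / ν) T, ∀ x ∈ ball y lam, ‖u t x‖ ≤ A₀) ∧
      (∀ t ∈ Ioo (T - lam ^ 2 / ν) T, ∀ x ∈ ball y lam, |p t x - p t y| ≤ P₀) := by
  -- distance to the apex and the margin inside the Type-I ball
  set d : ℝ := dist y x₀ with hd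
  have hd0 : 0 < d := dist_pos.2 hy0
  have hdρ : d < ρ := mem_ball.1 hy
  -- the big scale `Λ ≤ min(d/2, (ρ−d)/2, …)` with `Λ²/ν < min(T, ρ²)`
  set Λ : ℝ := min (min (d / 2) ((ρ - d) / 2)) (Real.sqrt (ν * min T (ρ ^ 2) / 2)) with hΛ_def
  have hmin0 : 0 < min T (ρ ^ 2) := lt_min hT (by positivity)
  have hΛ : 0 < Λ := lt_min (lt_min (by positivity) (by linarith)) (Real.sqrt_pos.2 (by positivity))
  have hΛd : Λ ≤ d / 2 := (min_le_left _ _).trans (min_le_left _ _)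
  have hΛρ : Λ ≤ (ρ - d) / 2 := (min_le_left _ _).trans (min_le_right _ _)
  have hΛ2 : Λ ^ 2 / ν ≤ min T (ρ ^ 2) / 2 := by
    have h1 : Λ ≤ Real.sqrt (ν * min T (ρ ^ 2) / 2) := min_le_right _ _
    have h2 : Λ ^ 2 ≤ ν * min T (ρ ^ 2) / 2 := by
      calc Λ ^ 2 ≤ (Real.sqrt (ν * min T (ρ ^ 2) / 2)) ^ 2 := pow_le_pow_left₀ hΛ.le h1 2
        _ = ν * min T (ρ ^ 2) / 2 := Real.sq_sqrt (by positivity)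
    rw [div_le_iff₀ hν]; linarith
  have hβ₂T : Λ ^ 2 / ν < T := by
    have := min_le_left T (ρ ^ 2); linarith
  have hβ₂ρ : Λ ^ 2 / ν < ρ ^ 2 := by
    have := min_le_right T (ρ ^ 2); linarith
  -- the ball `B(y,Λ)` lies in the punctured Type-I ball, at distance `≥ d/2` from the apex
  have hballΛ : ∀ x ∈ ball y Λ, x ∈ ball x₀ ρ ∧ d / 2 ≤ ‖x - x₀‖ := by
    intro x hx
    rw [mem_ball] at hx
    have h1 : dist x x₀ ≤ dist x y + dist y x₀ := dist_triangle _ _ _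
    have h2 : dist y x₀ ≤ dist y x + dist x x₀ := dist_triangle _ _ _
    rw [dist_comm y x] at h2
    refine ⟨mem_ball.2 (by linarith), ?_⟩
    rw [← dist_eq_norm]; linarith
  -- velocity bound `A₀ = 2|M|/d` on `[T − Λ²/ν, T) × B(y,Λ)`
  set A₀ : ℝ := 2 * |M| / d with hA₀
  have hA₀0 : 0 ≤ A₀ := by positivity
  have hvel : ∀ t ∈ Ico (T - Λ ^ 2 / ν) T, ∀ x ∈ ball y Λ, ‖u t x‖ ≤ A₀ := by
    intro t ht x hx
    obtain ⟨hxρ, hxd⟩ := hballΛ x hx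
    have htI : t ∈ Ico 0 T := ⟨by linarith [ht.1, hβ₂T.le], ht.2⟩
    have htρ : T - ρ ^ 2 < t := by linarith [ht.1]
    have key := hM t htI htρ x hxρ
    have h1 : ‖u t x‖ * (d / 2) ≤ |M| :=
      calc ‖u t x‖ * (d / 2) ≤ ‖u t x‖ * (‖x - x₀‖ + Real.sqrt (ν * (T - t))) :=
            mul_le_mul_of_nonneg_left (hxd.trans (le_add_of_nonneg_right (Real.sqrt_nonneg _))) (norm_nonneg _)
        _ ≤ M := key
        _ ≤ |M| := le_abs_self M
    rw [hA₀, le_div_iff₀ hd0]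
    linarith
  -- gradient bound on `(T − Λ²/(4ν), T) × B(y, Λ/2)`
  obtain ⟨M₁, hM₁⟩ := exists_offApex_fderiv_bound hν hT hcl hLH y hΛ hβ₂T hvel
  -- the small scale `λ = Λ/4`, `β = λ²/ν`
  set lam : ℝ := Λ / 4 with hlam
  have hlam0 : 0 < lam := by positivity
  have hβ : lam ^ 2 / ν = Λ ^ 2 / ν / 16 := by rw [hlam]; ring
  have hΛ2ν : 0 < Λ ^ 2 / ν := by positivity
  have hβT : lam ^ 2 / ν < T := by linarith [hβ]
  -- energy level
  set E₀ : ℝ := VectorCalculus.kineticEnergy (u 0) with hE₀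
  set B : ℝ := A₀ ^ 2 / 3 + 8 * A₀ * |M₁| * lam + (2 * Real.pi)⁻¹ * ((lam ^ 3)⁻¹ * (2 * |E₀|)) with hB
  have hB0 : 0 ≤ B := by positivity
  -- KEY CLAIM: `|p̃[u(t)](x)| ≤ B` for `t ∈ (T − λ²/ν, T)`, `x ∈ B(y, λ)`
  have hT2 : 0 ≤ T - lam ^ 2 / ν := by linarith
  have KC : ∀ t ∈ Ioo (T - lam ^ 2 / ν) T, ∀ x ∈ ball y lam, |normalisedPressure (u t) x| ≤ B := by
    intro t ht x hx
    have htI : t ∈ Ico 0 T := ⟨by linarith [ht.1], ht.2⟩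
    have hC1 : ContDiff ℝ 1 (u t) := (hcl.contDiff_velocity htI).of_le (by exact_mod_cast le_top)
    have hEn : (∫⁻ z, ‖u t z‖ₑ ^ 2) ≤ ENNReal.ofReal (2 * E₀) := hLH.lintegral_enorm_sq_le hν.le ⟨htI.1, htI.2.le⟩
    have hEn' : (∫⁻ z, ‖u t z‖ₑ ^ 2) ≤ ENNReal.ofReal (2 * |E₀|) :=
      hEn.trans (ENNReal.ofReal_le_ofReal (by linarith [le_abs_self E₀]))
    have hEt : (∫⁻ z, ‖u t z‖ₑ ^ 2) < ⊤ := lt_of_le_of_lt hEn ENNReal.ofReal_lt_top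
    -- the `λ`-ball about `x` lies in `B(y, Λ/2)`
    have hsub : ∀ x' ∈ closedBall x lam, x' ∈ ball y (Λ / 2) := by
      intro x' hx'
      rw [mem_closedBall] at hx'
      rw [mem_ball] at hx ⊢
      have := dist_triangle x' x y
      rw [hlam] at hx hx'
      linarith
    have hM₀ : ∀ x' ∈ closedBall x lam, ‖u t x'‖ ≤ A₀ := fun x' hx' =>
      hvel t ⟨by linarith [ht.1, hβ], ht.2⟩ x' (ball_subset_ball (by linarith) (hsub x' hx'))
    have hM₁' : ∀ x' ∈ closedBall x lam, ‖fderiv ℝ (u t) x'‖ ≤ |M₁| := fun x' hx' =>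
      (hM₁ t ⟨by linarith [ht.1, hβ], ht.2⟩ x' (hsub x' hx')).trans (le_abs_self _)
    have hfar := weightedFar_le_of_energy hC1.continuous (abs_nonneg E₀) hEn' x hlam0
    have hmain := abs_normalisedPressure_le_weighted_scale hC1 hEt x hlam0 hM₀ hM₁'
    calc |normalisedPressure (u t) x|
        ≤ A₀ ^ 2 / 3 + 8 * A₀ * |M₁| * lam +
            (2 * Real.pi)⁻¹ * ∫ x' in (closedBall x lam)ᶜ, ‖u t x'‖ ^ 2 / ‖x - x'‖ ^ 3 := hmain
      _ ≤ A₀ ^ 2 / 3 + 8 * A₀ * |M₁| * lam + (2 * Real.pi)⁻¹ * ((lam ^ 3)⁻¹ * (2 * |E₀|)) := by gcongr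
      _ = B := rfl
  -- the gauge step
  have hG := abs_pressure_sub_le_of_normalisedPressure_le hν hT hcl hLH (a := T - lam ^ 2 / ν) (b := T) hT2 le_rfl KC
  refine ⟨lam, A₀, 2 * B, hlam0, hβT, hA₀0, by positivity, fun x hx => ?_, fun t ht x hx => ?_, fun t ht x hx => ?_⟩
  · obtain ⟨hxρ, hxd⟩ := hballΛ x (ball_subset_ball (by rw [hlam]; linarith) hx)
    refine ⟨hxρ, fun h => ?_⟩
    rw [h, sub_self, norm_zero] at hxd
    linarith
  · exact hvel t ⟨by linarith [ht.1, hβ], ht.2⟩ x (ball_subset_ball (by rw [hlam]; linarith) hx)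
  · exact hG t ht x hx y (mem_ball_self hlam0)

end Summit.NavierStokesRegularity.NavierStokesRegularity.Theorems.QuietScarPocketDoor

end
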